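import Mathlib
import Literature.NumberTheory.LFunctions.Zhang2022.SkeletonPartTwo
import Literature.NumberTheory.LFunctions.Zhang2022.SkeletonAssembly
import Literature.NumberTheory.LFunctions.Zhang2022.Section10Certificate
import HarnessLib

/-!
# Zhang (2022), typed statements: §10c — the evaluations of `Θ₁(𝐚₁₄,𝐚₂₂)`, `Θ₁(𝐚₁₂,𝐚₁₄)`,
# (10.14)–(10.17) and the `𝔡′/𝔡` endgame of the proof of Proposition 2.4

Topic `Literature/NumberTheory/LFunctions/Zhang2022` (Landau–Siegel audit tree; verdict-neutral).
Y. Zhang, *Discrete mean estimates and the Landau–Siegel zero*, arXiv:2211.02515v1 (2022)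
[Zhang2022LandauSiegel], §10, PDF pp. 59–62, source `lsz3__2_.tex` lines L3014–L3187 —
**an unrefereed manuscript under adjudication. Every `def … : Prop` below is a CLAIM OF THE
MANUSCRIPT, STATED (statement-exact, constants verbatim) and NOT ASSERTED; nothing here asserts
or denies its Theorems 1–2.** D-0069 campaign file `TypedSection10C` (layer L3, seat L3-t8; DAG
nodes `Z22:§10.u047 … Z22:§10.u067`, `Z22:(10.14)`–`Z22:(10.17)` of `plan/DAG.tsv`).

What this file does. The second half of the proof of Proposition 2.4 (§10, "`|Ξ₁*| > 5𝔞𝔓`")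
evaluates the last two of the four `Θ₁`-terms of (10.1) — `Θ₁(𝐚₁₄,𝐚₂₂)` ((10.14)) and
`Θ₁(𝐚₁₂,𝐚₁₄)` ((10.15)–(10.16)) — range by range in `dr`, gathers them into the printed constants
`d′₅ⱼ, d₅ⱼ, d′₆ⱼ, d₆ⱼ`, concludes `Ξ₁* = (𝔡′ + 𝔡)𝔞𝔓 + o(𝔓)` ((10.17)) and finishes with the crude
numerical bounds `Re 𝔡′ > 5.1`, `|Re 𝔡| < 0.1`. Every displayed claim of that passage is typed here
as a named `Prop` over the banked skeleton's REAL objects (`Skeleton.Sj`, `Skeleton.Theta1`,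
`Skeleton.a12/a14/a22`, `Skeleton.lamZero`, `Skeleton.xiZero`, `Skeleton.frakfW/frakgW`
(`𝔣_{jμ}, 𝔤_{jμ}`), `Skeleton.fraky1/fraky2` (`𝔶_{1j}, 𝔶_{2j}`), `Skeleton.betaJ`, …), and every
printed CONSTANT is the tree's own transcription (`Section10Defs`: `d5pF/d5p1–3`, `d5F/d51–53`,
`d6pF/d6p1–3`, `d6F/d61–63`, `dprime`, `dfrak`, `Ineq10a–d`, `Prop24Main`; `Section8Defs`:
`ff16 … gh37`, `Section10Defs.yy11 … yy23`; `Section18Defs`: `iota3`, `iota4`) — CITED, never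
re-declared. Nodes the tree already types are typed BY REFERENCE (table below); the finer
proof-step claims around them are new `def`s in the namespace `…Zhang2022.Typed.Sec10C`.

Kernel-checked content (bookkeeping only, no analytic number theory): `dprime_display`,
`dfrak_display` (the tree's `𝔡′`, `𝔡` ARE the printed displays, `rfl`); `ffGhAtZero_holds`
(`𝔣𝔣_{jμ}(0) = 𝔤𝔥_{jμ}(0) = 1`); `dprimeApprox_holds` (the printed `𝔡′ ≃ −8ι₃/(0.498π)` in the
real-part form the text uses, from the tree's certificate); `prop24Main_of_printed_bounds` (the
sentence "Combining these bounds … we complete the proof of Proposition 2.4": the two printed crude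
bounds imply `|𝔡′ + 𝔡| > 5`, the tree's `Prop24Main`, whence `Skeleton.prop24_of_eval`); and the
edge `eval1017_of_eqs` ("It follows from (10.1) and (10.12)–(10.16) that (10.17)"), which refines
the banked coarse deduction node `Skeleton.Ded1017`: (10.1) + (10.12) + (10.13) + (10.14) + (10.16)
⊢ (10.17), the constants matching `dprime + dfrak` on the nose. Appended (second filing):
`DedProp24` — the whole §10 deduction `Z22:Prop2.4.pf` as ONE implication (layer naming convention,
`plan/L3/ASSIGNMENTS.md` §0b) — with `dedProp24_holds` / `prop24_of_section10_claims`: Proposition 2.4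
is a THEOREM modulo the five typed analytic inputs (10.1), (10.12), (10.13), (10.14), (10.16), the
crude numerical bounds and `𝔞 ≫ 1` being discharged from the tree (`Ineq10a/b/c_holds`,
`Skeleton.frakALowerBound_holds`, `Skeleton.prop24_of_eval`). The discharges of the bookkeeping
steps u047/u048/u051/u054/u055/u058 (expansion, split, gathering) belong to the cell's discharge
provers (held on the board), not to this file.

| DAG node | locator | decl(s) here / tree reference | content |
|---|---|---|---|
| `Z22:§10.u047` | p.59, tex L3018 | `mSum14`, `nSum22`, `term1422`, `SjExpand1422` | `S_j(𝐚₁₄,𝐚₂₂) = Σ_rΣ_d |χ(d)||μχ(r)|λ₀ⱼ(dr)/(drφ(r))(Σ_m …)(Σ_n …)` |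
| `Z22:§10.u048` | p.59, tex L3025 | `S1422On`, `Split1422` | split by `dr < P^{0.496}`, `P^{0.496} ≤ dr < P^{0.498}`, `P^{0.498} ≤ dr < P^{0.5}` |
| `Z22:§10.u049` | p.59, tex L3028 | `Low1422Small`, `midSum1422`, `midInt1422`, `Mid1422Eval`, `Mid1422Int` | low range `o(α)`; middle range `= (n-sum) + o(α) = (z-integral) + o(α)` |
| `Z22:§10.u050` | p.60, tex L3040 | `topSum1422`, `topInt1422`, `Top1422Eval`, `Top1422Int` | top range `= … + o(α) = … + o(α)` |
| `Z22:§10.u051` | p.60, tex L3050 | `d5pJ`, `d5J`, `Gather1422` | `α⁻¹S_j(𝐚₁₄,𝐚₂₂) = (d′₅ⱼ + d₅ⱼ)𝔞 + o(1)` |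
| `Z22:§10.u052` | p.60, tex L3053 | tree `Zhang2022.d5pF`, `d5p1–3` (ref.; `d5pJ_spec`) | `d′₅ⱼ = −(500ι₃/(0.498π))∫₀^{0.002}𝔤𝔥ⱼ₆` |
| `Z22:§10.u053` | p.60, tex L3056 | tree `Zhang2022.d5F`, `d51–53` (ref.; `d5J_spec`) | `d₅ⱼ` (three integrals) |
| `Z22:(10.14)` | p.60, tex L3063 | `Eq1014`, `Ded1014` | `Θ₁(𝐚₁₄,𝐚₂₂) = (½(d′₅₁+d₅₁) + 2(d′₅₂+d₅₂) + 3/2(d′₅₃+d₅₃))𝔞𝔓 + o(𝔓)` |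
| `Z22:§10.u054` | p.60, tex L3073 | `mSum12`, `nSum14`, `term1214`, `SjExpand1214` | `S_j(𝐚₁₂,𝐚₁₄) = …` |
| `Z22:§10.u055` | p.60, tex L3081 | `S1214On`, `Split1214`, `lowSum1214`, `lowX1214`, `lowInt1214`, `Low1214Eval`, `Low1214X`, `Low1214Int` | low range `= (n-sum) + o(α) = (x-integral) + o(α) = (z-integral) + o(α)` |
| `Z22:§10.u056` | p.61, tex L3089 | `midSum1214`, `midInt1214`, `Mid1214Eval`, `Mid1214Int` | middle range |
| `Z22:§10.u057` | p.61, tex L3101 | `topSum1214`, `topInt1214`, `Top1214Eval`, `Top1214Int` | top range |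
| `Z22:§10.u058` | p.61, tex L3111 | `d6pJ`, `d6J`, `Gather1214` | `α⁻¹S_j(𝐚₁₂,𝐚₁₄) = (d′₆ⱼ + d₆ⱼ)𝔞 + o(1)` |
| `Z22:(10.15)` | p.61, tex L3114 | tree `Zhang2022.d6pF`, `d6p1–3` (ref.; `d6pJ_spec`) | `d′₆ⱼ = −(500ῑ₃/(0.498π))∫₀^{0.002}𝔣𝔣ⱼ₆` |
| `Z22:§10.u059` | p.61, tex L3117 | tree `Zhang2022.d6F`, `d61–63` (ref.; `d6J_spec`) | `d₆ⱼ` (four integrals, `11 − 6j + j² = 6, 3, 2`) |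
| `Z22:(10.16)` | p.61, tex L3130 | `Eq1016`, `Eq1016Verbatim`, `Ded1016` | `Θ₁(𝐚₁₂,𝐚₁₄) = (…)𝔞𝔓 + o(𝔓)` (printed parenthesis slip recorded) |
| `Z22:(10.17)` | p.61, tex L3139 | banked `Skeleton.Eval1017 c′` (ref.); EDGE `eval1017_of_eqs` | `Ξ₁* = (𝔡′ + 𝔡)𝔞𝔓 + o(𝔓)` |
| `Z22:Prop2.4.pf` | §10 pp.53–62 | `DedProp24` (+ `dedProp24_holds`, `prop24_of_section10_claims`, PROVED) | (10.1) → (10.12) → (10.13) → (10.14) → (10.16) → crude bounds → `𝔞 ≫ 1` → Prop 2.4 |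
| `Z22:§10.u060` | p.61, tex L3143 | tree `Zhang2022.dprime` (ref.; `dprime_display`) | `𝔡′ = ½(d′₅₁ + d̄′₆₁) + 2(…) + 3/2(…)` |
| `Z22:§10.u061` | p.62, tex L3146 | tree `Zhang2022.dfrak` (ref.; `dfrak_display`) | `𝔡 = ½(d₃₁ + d₅₁ + conj(d₄₁ + d₆₁)) + …` |
| `Z22:§10.u062` | p.62, tex L3150 | `FfGhAtZero` (+ `ffGhAtZero_holds`) | `𝔣𝔣_{jμ}(0) = 𝔤𝔥_{jμ}(0) = 1`, `μ = 6, 7` |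
| `Z22:§10.u063` | p.62, tex L3153 | `DprimeApprox` (NUM; + `dprimeApprox_holds`) | `𝔡′ ≃ −8ι₃/(0.498π)` |
| `Z22:§10.u064` | p.62, tex L3157 | tree `Zhang2022.Ineq10a ∧ Ineq10b` (ref.; certified `Ineq10a_holds`, `Ineq10b_holds`) | `Re 𝔡′ > −(8/(0.498π))Re ι₃ − 0.04 > 5.1` |
| `Z22:§10.u065` | p.62, tex L3161 | `YYNearHalfSmall δ` (NUM, tolerance a parameter) | "`𝔶𝔶_{μj}(z) ≃ 0`" for `z` close to `1/2` |
| `Z22:§10.u066` | p.62, tex L3165 | tree `Zhang2022.Ineq10c` (ref.; certified `Ineq10c_holds`); EDGE `prop24Main_of_printed_bounds` | `|Re 𝔡| < 0.1`; "Combining these bounds …" |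
| `Z22:§10.u067` | p.62, tex L3173 | tree `Zhang2022.Ineq10d` (ref.; certified `Ineq10d_holds`) | Remark: `Re 𝔡 > 0` |

Conventions (fixed for layer L3, `plan/L3/ASSIGNMENTS.md` §0). The standing frame of every claim
is the skeleton's `ForAllLarge fun D _ χ => AssumptionA D χ → …` ("`D` sufficiently large", `χ` the
real primitive character mod `D`, Assumption (A) in force from §5 on); "`X = Y + o(α)`" is
`∀ ε > 0, … ‖X − Y‖ ≤ ε·α`; "`= (…)𝔞 + o(1)`" is `… ≤ ε`; "`= (…)𝔞𝔓 + o(𝔓)`" is `… ≤ ε·𝔓`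
(as `Skeleton.Eval1017`); the index `j` ranges over `{1, 2, 3}` (as `Skeleton.Lemma101`); a range
"`P^a ≤ n < P^b`" of a sum over positive integers is `Finset.Ico ⌈P^a⌉ ⌈P^b⌉`, "`n < P^b`" is
`Finset.Ico 1 ⌈P^b⌉` (as `Skeleton.H11`); `|χ(n)|` is `‖χ n‖`, `L′(1,χ)` is `deriv χ.LFunction 1`,
`φ` is `Nat.totient`. The `j`-indexed printed functions/constants are selected by `byJ`
(`ffJ6 1 = ff16`, …). The two SHIFTED forms of Lemmas 10.1/10.2 ("a result similar to Lemma 10.1",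
Remark p. 57) that justify the range claims are L3-t2's nodes (`TypedSection10B`); here they are
only cited in docstrings (the claims, not their deductions from the shifted lemmas, are the nodes of
this span), and the deduction nodes `Ded1014`/`Ded1016` take them as explicit `Prop` ARGUMENTS.
Printed slips recorded verbatim: "`p^{0.496} ≤ n`", "`p^{0.498} ≤ n`" (lower-case `p` for `P`,
tex L3091/L3103); the unbalanced "`3/2 d′₆₃ + d₆₃)`" of (10.16) (`Eq1016Verbatim`); "Combining these
bounds with (10.16)" where (10.17) is meant (p. 62). Numerical nodes carry their `plan/NUMERICS.tsv` id (`NUM:N-05` for the `𝔡′/𝔡` bounds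
u063/u064/u066/u067, `NUM:N-16` for u062; u065's tolerance has no row: `NUM:pending`).

## References

* Y. Zhang, arXiv:2211.02515v1 (2022), §10 pp. 59–62, (10.14)–(10.17); §7 Prop. 7.1; §8 Lemmas
  8.2–8.4; §10 Lemmas 10.1–10.2 and the Remark p. 57. [cite: Zhang2022LandauSiegel, §10 pp. 59–62]
-/

noncomputable section

open Complex Real ComplexConjugate
open Literature.NumberTheory.LFunctions.Zhang2022.Skeleton

namespace Literature.NumberTheory.LFunctions.Zhang2022.Typed.Sec10C

/-! ## Selecting the `j`-indexed printed functions and constants (`j = 1, 2, 3`) -/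

/-- Selector for a `j`-indexed triple (`j = 1, 2, 3`; any other index is sent to the third entry).
[cite: Zhang2022LandauSiegel, §10 p. 57] -/
def byJ {α : Type*} (x₁ x₂ x₃ : α) (j : ℕ) : α := if j = 1 then x₁ else if j = 2 then x₂ else x₃

/-- `𝔣𝔣_{j6}` ((8.13)–(8.15); the tree's `ff16, ff26, ff36`). [cite: Zhang2022LandauSiegel, §8 (8.13)–(8.15)] -/
def ffJ6 : ℕ → ℝ → ℂ := byJ ff16 ff26 ff36

/-- `𝔣𝔣_{j7}` ((8.16)–(8.18); the tree's `ff17, ff27, ff37`). [cite: Zhang2022LandauSiegel, §8 (8.16)–(8.18)] -/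
def ffJ7 : ℕ → ℝ → ℂ := byJ ff17 ff27 ff37

/-- `𝔤𝔥_{j6}` ((8.13)–(8.15); the tree's `gh16, gh26, gh36`). [cite: Zhang2022LandauSiegel, §8 (8.13)–(8.15)] -/
def ghJ6 : ℕ → ℝ → ℂ := byJ gh16 gh26 gh36

/-- `𝔤𝔥_{j7}` ((8.16)–(8.18); the tree's `gh17, gh27, gh37`). [cite: Zhang2022LandauSiegel, §8 (8.16)–(8.18)] -/
def ghJ7 : ℕ → ℝ → ℂ := byJ gh17 gh27 gh37

/-- `𝔶𝔶_{1j}` (§10 p. 57; the tree's `yy11, yy12, yy13`). [cite: Zhang2022LandauSiegel, §10 p. 57] -/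
def yyJ1 : ℕ → ℝ → ℂ := byJ yy11 yy12 yy13

/-- `𝔶𝔶_{2j}` (§10 p. 57; the tree's `yy21, yy22, yy23`). [cite: Zhang2022LandauSiegel, §10 p. 57] -/
def yyJ2 : ℕ → ℝ → ℂ := byJ yy21 yy22 yy23

/-- `d′_{5j}` (§10 p. 60, first display before (10.14); the tree's `d5p1, d5p2, d5p3`).
[cite: Zhang2022LandauSiegel, §10 p. 60] -/
def d5pJ : ℕ → ℂ := byJ d5p1 d5p2 d5p3

/-- `d_{5j}` (§10 p. 60, second display before (10.14); the tree's `d51, d52, d53`).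
[cite: Zhang2022LandauSiegel, §10 p. 60] -/
def d5J : ℕ → ℂ := byJ d51 d52 d53

/-- `d′_{6j}` ((10.15); the tree's `d6p1, d6p2, d6p3`). [cite: Zhang2022LandauSiegel, §10 (10.15) p. 61] -/
def d6pJ : ℕ → ℂ := byJ d6p1 d6p2 d6p3

/-- `d_{6j}` (§10 p. 61, display after (10.15); the tree's `d61, d62, d63`).
[cite: Zhang2022LandauSiegel, §10 p. 61] -/
def d6J : ℕ → ℂ := byJ d61 d62 d63

/-- **Z22:§10.u052 by reference** — "`d′_{5j} = −(500ι₃/(0.498π))∫₀^{0.002}𝔤𝔥_{j6}(z)dz`"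
[Z22 p.60, tex L3053] IS the tree's `d5pF` at `𝔤𝔥_{j6}` for `j = 1, 2, 3` (`Section10Defs`).
[cite: Zhang2022LandauSiegel, §10 p. 60] -/
theorem d5pJ_spec : d5pJ 1 = d5pF (ghJ6 1) ∧ d5pJ 2 = d5pF (ghJ6 2) ∧ d5pJ 3 = d5pF (ghJ6 3) :=
  ⟨rfl, rfl, rfl⟩

/-- **Z22:§10.u053 by reference** — "`d_{5j} = (1000ι₄/π)∫₀^{0.002}(𝔤𝔥_{j7}(z) − 𝔤𝔥_{j7}(0.002+z))dz
− (500ijι₃/0.498)∫₀^{0.002}(0.002 − z)𝔤𝔥_{j6}(z)dz − 1000ijι₄∫₀^{0.002}((0.002 − z)𝔤𝔥_{j7}(0.002+z)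
+ z𝔤𝔥_{j7}(z))dz`" [Z22 p.60, tex L3056] IS the tree's `d5F j 𝔤𝔥_{j6} 𝔤𝔥_{j7}`.
[cite: Zhang2022LandauSiegel, §10 p. 60] -/
theorem d5J_spec :
    d5J 1 = d5F 1 (ghJ6 1) (ghJ7 1) ∧ d5J 2 = d5F 2 (ghJ6 2) (ghJ7 2) ∧ d5J 3 = d5F 3 (ghJ6 3) (ghJ7 3) :=
  ⟨rfl, rfl, rfl⟩

/-- **Z22:(10.15) by reference** — "`d′_{6j} = −(500ῑ₃/(0.498π))∫₀^{0.002}𝔣𝔣_{j6}(z)dz` (10.15)"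
[Z22 p.61, (10.15), tex L3114] IS the tree's `d6pF` at `𝔣𝔣_{j6}`. [cite: Zhang2022LandauSiegel, §10 (10.15) p. 61] -/
theorem d6pJ_spec : d6pJ 1 = d6pF (ffJ6 1) ∧ d6pJ 2 = d6pF (ffJ6 2) ∧ d6pJ 3 = d6pF (ffJ6 3) :=
  ⟨rfl, rfl, rfl⟩

/-- **Z22:§10.u059 by reference** — "`d_{6j} = −((11−6j+j²)π/500)∫₀^{0.496}(ῑ₃𝔣𝔣_{j6}(0.002+z)/0.498
+ ῑ₄𝔣𝔣_{j7}(0.004+z)/0.5)dz + (1000ῑ₄/π)∫₀^{0.002}(𝔣𝔣_{j7}(z) − 𝔣𝔣_{j7}(0.002+z))dz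
+ (500/π)∫₀^{0.002}(ῑ₃𝔣𝔣_{j6}(z)/0.498 + ῑ₄𝔣𝔣_{j7}(0.002+z)/0.5)𝔶𝔶_{1j}(0.502−z)dz
+ (1000ῑ₄/π)∫₀^{0.002}𝔣𝔣_{j7}(z)𝔶𝔶_{2j}(0.504−z)dz`" [Z22 p.61, tex L3117] IS the tree's
`d6F n 𝔣𝔣_{j6} 𝔣𝔣_{j7} 𝔶𝔶_{1j} 𝔶𝔶_{2j}` with `n = 11 − 6j + j² = 6, 3, 2`.
[cite: Zhang2022LandauSiegel, §10 p. 61] -/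
theorem d6J_spec :
    d6J 1 = d6F 6 (ffJ6 1) (ffJ7 1) (yyJ1 1) (yyJ2 1) ∧
      d6J 2 = d6F 3 (ffJ6 2) (ffJ7 2) (yyJ1 2) (yyJ2 2) ∧
      d6J 3 = d6F 2 (ffJ6 3) (ffJ7 3) (yyJ1 3) (yyJ2 3) :=
  ⟨rfl, rfl, rfl⟩

/-! ## Objects of the evaluation of `Θ₁(𝐚₁₄,𝐚₂₂)` (p. 59–60) -/

section Objects

variable (c' : ℝ) {D : ℕ} [NeZero D] (χ : DirichletCharacter ℂ D)

/-- The weighted `n`-average recurring in every range display of §10: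
`Σ_{lo ≤ n < hi} |χ(n)|λ₀ⱼ(n)φ(n)⁻¹ g(n)` (for "`n < hi`" take `lo = 1`).
[cite: Zhang2022LandauSiegel, §10 pp. 57–61] -/
def lamAvg (j : ℕ) (lo hi : ℝ) (g : ℕ → ℂ) : ℂ :=
  ∑ n ∈ Finset.Ico ⌈lo⌉₊ ⌈hi⌉₊, (‖χ (n : ZMod D)‖ : ℂ) * lamZero c' D j n / (Nat.totient n : ℂ) * g n

/-- The `m`-sum of the display for `S_j(𝐚₁₄,𝐚₂₂)`:
`Σ_m χ(m)f̃(log(drm)/log P + 0.004 − α̃)m^{−(1−β_j)}` (finite: the skeleton's truncation `m < ⌈PT⁻²⌉`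
of `Skeleton.Sj`; `f̃` = `Skeleton.ftilde`, `α̃` = `Skeleton.alphaTilde`). Z22:§10.u047.
[cite: Zhang2022LandauSiegel, §10 p. 59] -/
def mSum14 (j d r : ℕ) : ℂ :=
  ∑ m ∈ Finset.Ico 1 (Nsupp D), χ (m : ZMod D) *
    (ftilde (Real.log ((d * r * m : ℕ) : ℝ) / Real.log (bigP D) + 0.004 - alphaTilde D) : ℂ) /
      (m : ℂ) ^ (1 - betaJ c' D j)

/-- The `n`-sum of the display for `S_j(𝐚₁₄,𝐚₂₂)`:
`Σ_n χ(n)(ι₃ϰ̄₃(drn) + ι₄ϰ̄₂(drn))ξ₀ⱼ(n;d,r)n⁻¹` (`ϰ₂, ϰ₃` = `Skeleton.vk2/vk3`, `ξ₀ⱼ` = `Skeleton.xiZero`,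
`ι₃, ι₄` = the tree's `iota3/iota4` of (2.26)). Z22:§10.u047. [cite: Zhang2022LandauSiegel, §10 p. 59] -/
def nSum22 (j d r : ℕ) : ℂ :=
  ∑ n ∈ Finset.Ico 1 (Nsupp D), χ (n : ZMod D) *
    (iota3 * conj (vk3 D (d * r * n)) + iota4 * conj (vk2 D (d * r * n))) *
      xiZero c' D j n d r / (n : ℂ)

/-- The `(d,r)`-summand of the display for `S_j(𝐚₁₄,𝐚₂₂)`:
`|χ(d)||μχ(r)|λ₀ⱼ(dr)/(drφ(r)) · (m-sum) · (n-sum)`. Z22:§10.u047. [cite: Zhang2022LandauSiegel, §10 p. 59] -/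
def term1422 (j d r : ℕ) : ℂ :=
  (‖χ (d : ZMod D)‖ : ℂ) * (‖(ArithmeticFunction.moebius r : ℂ) * χ (r : ZMod D)‖ : ℂ) *
      lamZero c' D j (d * r) / (((d * r : ℕ) : ℂ) * (Nat.totient r : ℂ)) *
    mSum14 c' χ j d r * nSum22 c' χ j d r

/-- The display for `S_j(𝐚₁₄,𝐚₂₂)` restricted to the range `lo ≤ dr < hi` ("The right side is split
into three sums according to `dr < P^{0.496}`, `P^{0.496} ≤ dr < P^{0.498}`, `P^{0.498} ≤ dr < P^{0.5}`").
Z22:§10.u048. [cite: Zhang2022LandauSiegel, §10 p. 59] -/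
def S1422On (j : ℕ) (lo hi : ℝ) : ℂ :=
  ∑ r ∈ Finset.Ico 1 (Nsupp D), ∑ d ∈ Finset.Ico 1 (Nsupp D),
    if lo ≤ ((d * r : ℕ) : ℝ) ∧ ((d * r : ℕ) : ℝ) < hi then term1422 c' χ j d r else 0

/-- The arithmetic form of the middle range (p. 59, display at tex L3028, first line):
`(500L′(1,χ)²/log²P) Σ_{P^{0.496}≤n<P^{0.498}} |χ(n)|λ₀ⱼ(n)φ(n)⁻¹ (−1 − β_j log(P^{−0.496}n))
(ι₃𝔤_{j6}(P^{0.498}/n)/0.498 + ι₄𝔤_{j7}(P^{0.5}/n)/0.5)` (`𝔤_{jμ}` = `Skeleton.frakgW`, Lemma 8.4).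
Z22:§10.u049. [cite: Zhang2022LandauSiegel, §10 p. 59] -/
def midSum1422 (j : ℕ) : ℂ :=
  500 * deriv χ.LFunction 1 ^ 2 / (Real.log (bigP D) : ℂ) ^ 2 *
    lamAvg c' χ j (bigP D ^ (0.496 : ℝ)) (bigP D ^ (0.498 : ℝ)) fun n =>
      (-1 - betaJ c' D j * (Real.log (bigP D ^ (-0.496 : ℝ) * n) : ℂ)) *
        (iota3 / 0.498 * frakgW c' D j 6 (bigP D ^ (0.498 : ℝ) / n) +
          iota4 / 0.5 * frakgW c' D j 7 (bigP D ^ (0.5 : ℝ) / n))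

/-- The integral form of the middle range (p. 59, display at tex L3028, second line):
`(500𝔞/log P)∫_{0.496}^{0.498}(−1 − πij(z − 0.496))(ι₃𝔤𝔥_{j6}(0.498 − z)/0.498 + ι₄𝔤𝔥_{j7}(0.5 − z)/0.5)dz`.
Z22:§10.u049. [cite: Zhang2022LandauSiegel, §10 p. 59] -/
def midInt1422 (j : ℕ) : ℂ :=
  500 * (frakA χ : ℂ) / (Real.log (bigP D) : ℂ) *
    ∫ z in (0.496 : ℝ)..0.498,
      (-1 - π * I * j * ((z - 0.496 : ℝ) : ℂ)) *
        (iota3 / 0.498 * ghJ6 j (0.498 - z) + iota4 / 0.5 * ghJ7 j (0.5 - z))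

/-- The arithmetic form of the top range (p. 60, display at tex L3040, first line):
`(500L′(1,χ)²/log²P)(ι₄/0.5) Σ_{P^{0.498}≤n<P^{0.5}} |χ(n)|λ₀ⱼ(n)φ(n)⁻¹ (1 − β_j log(P^{0.5}/n))𝔤_{j7}(P^{0.5}/n)`.
Z22:§10.u050. [cite: Zhang2022LandauSiegel, §10 p. 60] -/
def topSum1422 (j : ℕ) : ℂ :=
  500 * deriv χ.LFunction 1 ^ 2 / (Real.log (bigP D) : ℂ) ^ 2 * (iota4 / 0.5) *
    lamAvg c' χ j (bigP D ^ (0.498 : ℝ)) (bigP D ^ (0.5 : ℝ)) fun n =>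
      (1 - betaJ c' D j * (Real.log (bigP D ^ (0.5 : ℝ) / n) : ℂ)) *
        frakgW c' D j 7 (bigP D ^ (0.5 : ℝ) / n)

/-- The integral form of the top range (p. 60, display at tex L3040, second line):
`(1000ι₄𝔞/log P)∫_{0.498}^{0.5}(1 − πij(0.5 − z))𝔤𝔥_{j7}(0.5 − z)dz`. Z22:§10.u050.
[cite: Zhang2022LandauSiegel, §10 p. 60] -/
def topInt1422 (j : ℕ) : ℂ :=
  1000 * iota4 * (frakA χ : ℂ) / (Real.log (bigP D) : ℂ) *
    ∫ z in (0.498 : ℝ)..0.5, (1 - π * I * j * ((0.5 - z : ℝ) : ℂ)) * ghJ7 j (0.5 - z)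

/-! ## Objects of the evaluation of `Θ₁(𝐚₁₂,𝐚₁₄)` (p. 60–61) -/

/-- The `m`-sum of the display for `S_j(𝐚₁₂,𝐚₁₄)`: `Σ_m χ(m)(ῑ₃ϰ₃(drm) + ῑ₄ϰ₂(drm))m^{−(1−β_j)}`.
Z22:§10.u054. [cite: Zhang2022LandauSiegel, §10 p. 60] -/
def mSum12 (j d r : ℕ) : ℂ :=
  ∑ m ∈ Finset.Ico 1 (Nsupp D), χ (m : ZMod D) *
    (conj iota3 * vk3 D (d * r * m) + conj iota4 * vk2 D (d * r * m)) / (m : ℂ) ^ (1 - betaJ c' D j)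

/-- The `n`-sum of the display for `S_j(𝐚₁₂,𝐚₁₄)`:
`Σ_n χ(n)f̃(log(drn)/log P + 0.004 − α̃)ξ₀ⱼ(n;d,r)n⁻¹`. Z22:§10.u054. [cite: Zhang2022LandauSiegel, §10 p. 60] -/
def nSum14 (j d r : ℕ) : ℂ :=
  ∑ n ∈ Finset.Ico 1 (Nsupp D), χ (n : ZMod D) *
    (ftilde (Real.log ((d * r * n : ℕ) : ℝ) / Real.log (bigP D) + 0.004 - alphaTilde D) : ℂ) *
      xiZero c' D j n d r / (n : ℂ)

/-- The `(d,r)`-summand of the display for `S_j(𝐚₁₂,𝐚₁₄)`: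
`|χ(d)||μχ(r)|λ₀ⱼ(dr)/(drφ(r)) · (m-sum) · (n-sum)`. Z22:§10.u054. [cite: Zhang2022LandauSiegel, §10 p. 60] -/
def term1214 (j d r : ℕ) : ℂ :=
  (‖χ (d : ZMod D)‖ : ℂ) * (‖(ArithmeticFunction.moebius r : ℂ) * χ (r : ZMod D)‖ : ℂ) *
      lamZero c' D j (d * r) / (((d * r : ℕ) : ℂ) * (Nat.totient r : ℂ)) *
    mSum12 c' χ j d r * nSum14 c' χ j d r

/-- The display for `S_j(𝐚₁₂,𝐚₁₄)` restricted to the range `lo ≤ dr < hi` ("The right side is split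
into three sums in the same way as in the last subsection", p. 60). Z22:§10.u055.
[cite: Zhang2022LandauSiegel, §10 p. 60] -/
def S1214On (j : ℕ) (lo hi : ℝ) : ℂ :=
  ∑ r ∈ Finset.Ico 1 (Nsupp D), ∑ d ∈ Finset.Ico 1 (Nsupp D),
    if lo ≤ ((d * r : ℕ) : ℝ) ∧ ((d * r : ℕ) : ℝ) < hi then term1214 c' χ j d r else 0

/-- The arithmetic form of the low range of `S_j(𝐚₁₂,𝐚₁₄)` (p. 60, display at tex L3081, first line):
`(L′(1,χ)²/500) β_{j+1}β_{j+2} Σ_{n<P^{0.496}} |χ(n)|λ₀ⱼ(n)φ(n)⁻¹ (ῑ₃𝔣_{j6}(P^{0.498}/n)/0.498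
+ ῑ₄𝔣_{j7}(P^{0.5}/n)/0.5)` (`𝔣_{jμ}` = `Skeleton.frakfW`, Lemma 8.2; `β_{j+1}, β_{j+2}` with the §8
convention `β₄ = β₁, β₅ = β₂` = `Skeleton.betaJ`). Z22:§10.u055. [cite: Zhang2022LandauSiegel, §10 p. 60] -/
def lowSum1214 (j : ℕ) : ℂ :=
  deriv χ.LFunction 1 ^ 2 / 500 * (betaJ c' D (j + 1) * betaJ c' D (j + 2)) *
    lamAvg c' χ j 1 (bigP D ^ (0.496 : ℝ)) fun n =>
      conj iota3 * frakfW c' D j 6 (bigP D ^ (0.498 : ℝ) / n) / 0.498 +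
        conj iota4 * frakfW c' D j 7 (bigP D ^ (0.5 : ℝ) / n) / 0.5

/-- The `x`-integral form of the low range (p. 60, display at tex L3081, second line):
`(𝔞β_{j+1}β_{j+2}/500)∫₁^{P^{0.496}}(ῑ₃𝔣_{j6}(P^{0.498}/x)/0.498 + ῑ₄𝔣_{j7}(P^{0.5}/x)/0.5)dx/x`.
Z22:§10.u055. [cite: Zhang2022LandauSiegel, §10 p. 60] -/
def lowX1214 (j : ℕ) : ℂ :=
  (frakA χ : ℂ) * (betaJ c' D (j + 1) * betaJ c' D (j + 2)) / 500 *
    ∫ x in (1 : ℝ)..bigP D ^ (0.496 : ℝ),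
      (conj iota3 * frakfW c' D j 6 (bigP D ^ (0.498 : ℝ) / x) / 0.498 +
          conj iota4 * frakfW c' D j 7 (bigP D ^ (0.5 : ℝ) / x) / 0.5) / (x : ℂ)

/-- The `z`-integral form of the low range (p. 60, display at tex L3081, third line):
`(𝔞β_{j+1}β_{j+2}log P/500)∫₀^{0.496}(ῑ₃𝔣𝔣_{j6}(0.002 + z)/0.498 + ῑ₄𝔣𝔣_{j7}(0.004 + z)/0.5)dz`.
Z22:§10.u055. [cite: Zhang2022LandauSiegel, §10 p. 60] -/
def lowInt1214 (j : ℕ) : ℂ :=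
  (frakA χ : ℂ) * (betaJ c' D (j + 1) * betaJ c' D (j + 2)) * (Real.log (bigP D) : ℂ) / 500 *
    ∫ z in (0 : ℝ)..0.496,
      (conj iota3 * ffJ6 j (0.002 + z) / 0.498 + conj iota4 * ffJ7 j (0.004 + z) / 0.5)

/-- The arithmetic form of the middle range of `S_j(𝐚₁₂,𝐚₁₄)` (p. 61, display at tex L3089, printed
with "`p^{0.496} ≤ n`" [sic, `P`]): `(500L′(1,χ)²/log²P) Σ_{P^{0.496}≤n<P^{0.498}} |χ(n)|λ₀ⱼ(n)φ(n)⁻¹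
(ῑ₃𝔣_{j6}(P^{0.498}/n)/0.498 + ῑ₄𝔣_{j7}(P^{0.5}/n)/0.5)(−1 + 𝔶_{1j}(P^{0.004}n))` (`𝔶_{1j}` =
`Skeleton.fraky1`, (10.9)). Z22:§10.u056. [cite: Zhang2022LandauSiegel, §10 p. 61] -/
def midSum1214 (j : ℕ) : ℂ :=
  500 * deriv χ.LFunction 1 ^ 2 / (Real.log (bigP D) : ℂ) ^ 2 *
    lamAvg c' χ j (bigP D ^ (0.496 : ℝ)) (bigP D ^ (0.498 : ℝ)) fun n =>
      (conj iota3 * frakfW c' D j 6 (bigP D ^ (0.498 : ℝ) / n) / 0.498 +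
          conj iota4 * frakfW c' D j 7 (bigP D ^ (0.5 : ℝ) / n) / 0.5) *
        (-1 + fraky1 c' D j (bigP D ^ (0.004 : ℝ) * n))

/-- The integral form of the middle range (p. 61, display at tex L3089, second line):
`(500𝔞/log P)∫₀^{0.002}(ῑ₃𝔣𝔣_{j6}(z)/0.498 + ῑ₄𝔣𝔣_{j7}(0.002 + z)/0.5)(−1 + 𝔶𝔶_{1j}(0.502 − z))dz`.
Z22:§10.u056. [cite: Zhang2022LandauSiegel, §10 p. 61] -/
def midInt1214 (j : ℕ) : ℂ :=
  500 * (frakA χ : ℂ) / (Real.log (bigP D) : ℂ) *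
    ∫ z in (0 : ℝ)..0.002,
      (conj iota3 * ffJ6 j z / 0.498 + conj iota4 * ffJ7 j (0.002 + z) / 0.5) *
        (-1 + yyJ1 j (0.502 - z))

/-- The arithmetic form of the top range of `S_j(𝐚₁₂,𝐚₁₄)` (p. 61, display at tex L3101, printed
with "`p^{0.498} ≤ n`" [sic, `P`]): `(1000ῑ₄L′(1,χ)²/log²P) Σ_{P^{0.498}≤n<P^{0.5}} |χ(n)|λ₀ⱼ(n)φ(n)⁻¹
𝔣_{j7}(P^{0.5}/n)(1 + 𝔶_{2j}(P^{0.004}n))` (`𝔶_{2j}` = `Skeleton.fraky2`, (10.10)). Z22:§10.u057.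
[cite: Zhang2022LandauSiegel, §10 p. 61] -/
def topSum1214 (j : ℕ) : ℂ :=
  1000 * conj iota4 * deriv χ.LFunction 1 ^ 2 / (Real.log (bigP D) : ℂ) ^ 2 *
    lamAvg c' χ j (bigP D ^ (0.498 : ℝ)) (bigP D ^ (0.5 : ℝ)) fun n =>
      frakfW c' D j 7 (bigP D ^ (0.5 : ℝ) / n) * (1 + fraky2 c' D j (bigP D ^ (0.004 : ℝ) * n))

/-- The integral form of the top range (p. 61, display at tex L3101, second line):
`(1000ῑ₄𝔞/log P)∫₀^{0.002}𝔣𝔣_{j7}(z)(1 + 𝔶𝔶_{2j}(0.504 − z))dz`. Z22:§10.u057.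
[cite: Zhang2022LandauSiegel, §10 p. 61] -/
def topInt1214 (j : ℕ) : ℂ :=
  1000 * conj iota4 * (frakA χ : ℂ) / (Real.log (bigP D) : ℂ) *
    ∫ z in (0 : ℝ)..0.002, ffJ7 j z * (1 + yyJ2 j (0.504 - z))

end Objects

/-! ## The claims of the evaluation of `Θ₁(𝐚₁₄,𝐚₂₂)` — Z22:§10.u047–u053, (10.14) -/

section Claims1422

variable (c' : ℝ)

/-- **Z22:§10.u047** [Z22 p.59, tex L3018]: "We have `S_j(𝐚₁₄,𝐚₂₂) = Σ_r Σ_d |χ(d)||μχ(r)|λ₀ⱼ(dr)/(drφ(r))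
(Σ_m χ(m)f̃(log(drm)/log P + 0.004 − α̃)m^{−(1−β_j)}) (Σ_n χ(n)(ι₃ϰ̄₃(drn) + ι₄ϰ̄₂(drn))ξ₀ⱼ(n;d,r)n⁻¹)`"
— the skeleton's `S_j` (`Skeleton.Sj`, Prop. 7.1) at `𝐚₁ = 𝐚₁₄`, `𝐚₂ = 𝐚₂₂` (`Skeleton.a14/a22`;
`χ` real, so `χ(d)²χ(r)² = |χ(d)||χ(r)|`). CLAIM, stated not asserted.
[cite: Zhang2022LandauSiegel, §10 p. 59] -/
def SjExpand1422 : Prop :=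
  ForAllLarge fun D _ χ => AssumptionA D χ → ∀ j ∈ ({1, 2, 3} : Finset ℕ),
    Sj c' D j (a14 χ) (a22 χ) =
      ∑ r ∈ Finset.Ico 1 (Nsupp D), ∑ d ∈ Finset.Ico 1 (Nsupp D), term1422 c' χ j d r

/-- **Z22:§10.u048** [Z22 p.59, tex L3025]: "The right side is split into three sums according to
`dr < P^{0.496}`, `P^{0.496} ≤ dr < P^{0.498}`, `P^{0.498} ≤ dr < P^{0.5}`" — typed as the claim that
these three ranges exhaust the sum (the terms with `dr ≥ P^{0.5}` vanish: `ϰ₂, ϰ₃` are supported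
below `P₂ < P^{0.5}`, `P₃ = P^{0.498}`). CLAIM. [cite: Zhang2022LandauSiegel, §10 p. 59] -/
def Split1422 : Prop :=
  ForAllLarge fun D _ χ => AssumptionA D χ → ∀ j ∈ ({1, 2, 3} : Finset ℕ),
    ∑ r ∈ Finset.Ico 1 (Nsupp D), ∑ d ∈ Finset.Ico 1 (Nsupp D), term1422 c' χ j d r =
      S1422On c' χ j 0 (bigP D ^ (0.496 : ℝ)) +
        S1422On c' χ j (bigP D ^ (0.496 : ℝ)) (bigP D ^ (0.498 : ℝ)) +
        S1422On c' χ j (bigP D ^ (0.498 : ℝ)) (bigP D ^ (0.5 : ℝ))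

/-- **Z22:§10.u049 (i)** [Z22 p.59, tex L3027]: "By a result similar to Lemma 10.1 and the results in
Section 8, the sum over `dr < P^{0.496}` is `o(α)`" (the "result similar to Lemma 10.1" is the shifted
Lemma 10.1 of the Remark p. 57 — L3-t2's node in `TypedSection10B`; "the results in Section 8" =
Lemmas 8.2–8.4, `Skeleton.Lemma82/83/84`). CLAIM. [cite: Zhang2022LandauSiegel, §10 p. 59] -/
def Low1422Small : Prop :=
  ∀ ε : ℝ, 0 < ε → ForAllLarge fun D _ χ => AssumptionA D χ → ∀ j ∈ ({1, 2, 3} : Finset ℕ),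
    ‖S1422On c' χ j 0 (bigP D ^ (0.496 : ℝ))‖ ≤ ε * alpha D

/-- **Z22:§10.u049 (ii)** [Z22 p.59, tex L3028]: "the sum over `P^{0.496} ≤ dr < P^{0.498}` is equal to
`(500L′(1,χ)²/log²P) Σ_{P^{0.496}≤n<P^{0.498}} |χ(n)|λ₀ⱼ(n)φ(n)⁻¹(−1 − β_j log(P^{−0.496}n))
(ι₃𝔤_{j6}(P^{0.498}/n)/0.498 + ι₄𝔤_{j7}(P^{0.5}/n)/0.5) + o(α)`" (`= midSum1422 + o(α)`). CLAIM.
[cite: Zhang2022LandauSiegel, §10 p. 59] -/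
def Mid1422Eval : Prop :=
  ∀ ε : ℝ, 0 < ε → ForAllLarge fun D _ χ => AssumptionA D χ → ∀ j ∈ ({1, 2, 3} : Finset ℕ),
    ‖S1422On c' χ j (bigP D ^ (0.496 : ℝ)) (bigP D ^ (0.498 : ℝ)) - midSum1422 c' χ j‖ ≤ ε * alpha D

/-- **Z22:§10.u049 (iii)** [Z22 p.59, tex L3028, the continued equality]: "`… = (500𝔞/log P)
∫_{0.496}^{0.498}(−1 − πij(z − 0.496))(ι₃𝔤𝔥_{j6}(0.498 − z)/0.498 + ι₄𝔤𝔥_{j7}(0.5 − z)/0.5)dz + o(α)`"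
(`midSum1422 = midInt1422 + o(α)`: the §8 evaluation rule for `Σ|χ(n)|λ₀ⱼ(n)φ(n)⁻¹g(n)`,
`β_j log P^{u} = jπiu + O(𝓛⁻⁸)`, `𝔤_{jμ}(Pᶻ) = 𝔤𝔥_{jμ}(z) + O(𝓛⁻⁸)`, substitution `x = Pᶻ`; the
main-order identity behind it is the tree's `Section10MainTerms.S1422_eq_d5F`). CLAIM.
[cite: Zhang2022LandauSiegel, §10 p. 59] -/
def Mid1422Int : Prop :=
  ∀ ε : ℝ, 0 < ε → ForAllLarge fun D _ χ => AssumptionA D χ → ∀ j ∈ ({1, 2, 3} : Finset ℕ),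
    ‖midSum1422 c' χ j - midInt1422 χ j‖ ≤ ε * alpha D

/-- **Z22:§10.u050 (i)** [Z22 p.60, tex L3040]: "the sum over `P^{0.498} ≤ dr < P^{0.5}` is equal to
`(500L′(1,χ)²/log²P)(ι₄/0.5) Σ_{P^{0.498}≤n<P^{0.5}} |χ(n)|λ₀ⱼ(n)φ(n)⁻¹(1 − β_j log(P^{0.5}/n))
𝔤_{j7}(P^{0.5}/n) + o(α)`". CLAIM. [cite: Zhang2022LandauSiegel, §10 p. 60] -/
def Top1422Eval : Prop :=
  ∀ ε : ℝ, 0 < ε → ForAllLarge fun D _ χ => AssumptionA D χ → ∀ j ∈ ({1, 2, 3} : Finset ℕ),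
    ‖S1422On c' χ j (bigP D ^ (0.498 : ℝ)) (bigP D ^ (0.5 : ℝ)) - topSum1422 c' χ j‖ ≤ ε * alpha D

/-- **Z22:§10.u050 (ii)** [Z22 p.60, tex L3040, the continued equality]:
"`… = (1000ι₄𝔞/log P)∫_{0.498}^{0.5}(1 − πij(0.5 − z))𝔤𝔥_{j7}(0.5 − z)dz + o(α)`". CLAIM.
[cite: Zhang2022LandauSiegel, §10 p. 60] -/
def Top1422Int : Prop :=
  ∀ ε : ℝ, 0 < ε → ForAllLarge fun D _ χ => AssumptionA D χ → ∀ j ∈ ({1, 2, 3} : Finset ℕ),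
    ‖topSum1422 c' χ j - topInt1422 χ j‖ ≤ ε * alpha D

/-- **Z22:§10.u051** [Z22 p.60, tex L3050]: "Gathering the above results together we conclude
`α⁻¹S_j(𝐚₁₄,𝐚₂₂) = (d′_{5j} + d_{5j})𝔞 + o(1)`" with the printed `d′_{5j}, d_{5j}` (the tree's
`d5p1–3`, `d51–53`, Z22:§10.u052–u053). CLAIM. [cite: Zhang2022LandauSiegel, §10 p. 60] -/
def Gather1422 : Prop :=
  ∀ ε : ℝ, 0 < ε → ForAllLarge fun D _ χ => AssumptionA D χ → ∀ j ∈ ({1, 2, 3} : Finset ℕ),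
    ‖(alpha D : ℂ)⁻¹ * Sj c' D j (a14 χ) (a22 χ) - (d5pJ j + d5J j) * frakA χ‖ ≤ ε

/-- **Z22:(10.14)** [Z22 p.60, (10.14), tex L3063]: "Hence, by Proposition 7.1,
`Θ₁(𝐚₁₄,𝐚₂₂) = (½(d′₅₁ + d₅₁) + 2(d′₅₂ + d₅₂) + 3/2(d′₅₃ + d₅₃))𝔞𝔓 + o(𝔓)` (10.14)"
(`Θ₁` = `Skeleton.Theta1`; the constants are the tree's `d5p1 … d53`). CLAIM.
[cite: Zhang2022LandauSiegel, §10 (10.14) p. 60] -/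
def Eq1014 : Prop :=
  ∀ ε : ℝ, 0 < ε → ForAllLarge fun D _ χ => AssumptionA D χ →
    ‖Theta1 c' χ (a14 χ) (a22 χ) -
        (1 / 2 * (d5p1 + d51) + 2 * (d5p2 + d52) + 3 / 2 * (d5p3 + d53)) * frakA χ * frakP D‖
      ≤ ε * frakP D

/-- **The manuscript's deduction of the range claims for `S_j(𝐚₁₄,𝐚₂₂)`** (p. 59–60): "By a result
similar to Lemma 10.1 [the shifted Lemma 10.1 of the Remark p. 57, L3-t2's node, passed as the
argument `shiftedLemma101`] and the results in Section 8 [Lemmas 8.2–8.4]" ⊢ the three range claims.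
Refines `Skeleton.Ded1017`. CLAIM (a deduction node, typed as an implication).
[cite: Zhang2022LandauSiegel, §10 pp. 59–60] -/
def DedRanges1422 (shiftedLemma101 : Prop) : Prop :=
  shiftedLemma101 → Lemma82 c' → Lemma83 c' → Lemma84 c' →
    Low1422Small c' ∧ Mid1422Eval c' ∧ Mid1422Int c' ∧ Top1422Eval c' ∧ Top1422Int c'

/-- **The manuscript's deduction of (10.14)** (p. 60): the expansion, the split, the range claims and
the gathering give `α⁻¹S_j(𝐚₁₄,𝐚₂₂) = (d′_{5j} + d_{5j})𝔞 + o(1)`, "Hence, by Proposition 7.1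
[`Skeleton.Prop71`], (10.14)". Refines `Skeleton.Ded1017`. CLAIM (deduction node).
[cite: Zhang2022LandauSiegel, §10 (10.14) p. 60] -/
def Ded1014 : Prop :=
  SjExpand1422 c' → Split1422 c' → Low1422Small c' → Mid1422Eval c' → Mid1422Int c' →
    Top1422Eval c' → Top1422Int c' → Gather1422 c' → Prop71 c' → Eq1014 c'

end Claims1422

/-! ## The claims of the evaluation of `Θ₁(𝐚₁₂,𝐚₁₄)` — Z22:§10.u054–u059, (10.15), (10.16) -/

section Claims1214

variable (c' : ℝ)

/-- **Z22:§10.u054** [Z22 p.60, tex L3073]: "We have `S_j(𝐚₁₂,𝐚₁₄) = Σ_r Σ_d |χ(d)||μχ(r)|λ₀ⱼ(dr)/(drφ(r))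
(Σ_m χ(m)(ῑ₃ϰ₃(drm) + ῑ₄ϰ₂(drm))m^{−(1−β_j)}) (Σ_n χ(n)f̃(log(drn)/log P + 0.004 − α̃)ξ₀ⱼ(n;d,r)n⁻¹)`"
(`Skeleton.Sj` at `𝐚₁ = 𝐚₁₂ = Skeleton.a12`, `𝐚₂ = 𝐚₁₄ = Skeleton.a14`). CLAIM.
[cite: Zhang2022LandauSiegel, §10 p. 60] -/
def SjExpand1214 : Prop :=
  ForAllLarge fun D _ χ => AssumptionA D χ → ∀ j ∈ ({1, 2, 3} : Finset ℕ),
    Sj c' D j (a12 χ) (a14 χ) =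
      ∑ r ∈ Finset.Ico 1 (Nsupp D), ∑ d ∈ Finset.Ico 1 (Nsupp D), term1214 c' χ j d r

/-- **Z22:§10.u055 (split)** [Z22 p.60, tex L3079]: "The right side is split into three sums in the same
way as in the last subsection" (`dr < P^{0.496}`, `P^{0.496} ≤ dr < P^{0.498}`, `P^{0.498} ≤ dr < P^{0.5}`;
the terms with `dr ≥ P^{0.5}` vanish). CLAIM. [cite: Zhang2022LandauSiegel, §10 p. 60] -/
def Split1214 : Prop :=
  ForAllLarge fun D _ χ => AssumptionA D χ → ∀ j ∈ ({1, 2, 3} : Finset ℕ),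
    ∑ r ∈ Finset.Ico 1 (Nsupp D), ∑ d ∈ Finset.Ico 1 (Nsupp D), term1214 c' χ j d r =
      S1214On c' χ j 0 (bigP D ^ (0.496 : ℝ)) +
        S1214On c' χ j (bigP D ^ (0.496 : ℝ)) (bigP D ^ (0.498 : ℝ)) +
        S1214On c' χ j (bigP D ^ (0.498 : ℝ)) (bigP D ^ (0.5 : ℝ))

/-- **Z22:§10.u055 (i)** [Z22 p.60, tex L3081]: "By a result similar to Lemma 10.2 and the results in
Section 8, the sum over `dr < P^{0.496}` is equal to `(L′(1,χ)²/500)β_{j+1}β_{j+2} Σ_{n<P^{0.496}}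
|χ(n)|λ₀ⱼ(n)φ(n)⁻¹(ῑ₃𝔣_{j6}(P^{0.498}/n)/0.498 + ῑ₄𝔣_{j7}(P^{0.5}/n)/0.5) + o(α)`" (the "result
similar to Lemma 10.2" is the shifted Lemma 10.2 of the Remark p. 57 — L3-t2's node). CLAIM.
[cite: Zhang2022LandauSiegel, §10 p. 60] -/
def Low1214Eval : Prop :=
  ∀ ε : ℝ, 0 < ε → ForAllLarge fun D _ χ => AssumptionA D χ → ∀ j ∈ ({1, 2, 3} : Finset ℕ),
    ‖S1214On c' χ j 0 (bigP D ^ (0.496 : ℝ)) - lowSum1214 c' χ j‖ ≤ ε * alpha D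

/-- **Z22:§10.u055 (ii)** [Z22 p.60, tex L3081, second line]: "`… = (𝔞β_{j+1}β_{j+2}/500)∫₁^{P^{0.496}}
(ῑ₃𝔣_{j6}(P^{0.498}/x)/0.498 + ῑ₄𝔣_{j7}(P^{0.5}/x)/0.5)dx/x + o(α)`" (the §8 evaluation rule
`Σ_n|χ(n)|λ₀ⱼ(n)φ(n)⁻¹g(n) = (𝔞/L′(1,χ)²)∫g(x)dx/x + …`). CLAIM. [cite: Zhang2022LandauSiegel, §10 p. 60] -/
def Low1214X : Prop :=
  ∀ ε : ℝ, 0 < ε → ForAllLarge fun D _ χ => AssumptionA D χ → ∀ j ∈ ({1, 2, 3} : Finset ℕ),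
    ‖lowSum1214 c' χ j - lowX1214 c' χ j‖ ≤ ε * alpha D

/-- **Z22:§10.u055 (iii)** [Z22 p.60, tex L3081, third line]: "`… = (𝔞β_{j+1}β_{j+2}log P/500)
∫₀^{0.496}(ῑ₃𝔣𝔣_{j6}(0.002 + z)/0.498 + ῑ₄𝔣𝔣_{j7}(0.004 + z)/0.5)dz + o(α)`" (substitution `x = Pᶻ`,
`𝔣_{jμ}(Pᶻ) = 𝔣𝔣_{jμ}(z) + O(𝓛⁻⁸)`, reflection `z ↦ 0.496 − z`; main-order identity: the tree's
`Section10MainTerms.S1214_eq_d6F`). CLAIM. [cite: Zhang2022LandauSiegel, §10 p. 60] -/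
def Low1214Int : Prop :=
  ∀ ε : ℝ, 0 < ε → ForAllLarge fun D _ χ => AssumptionA D χ → ∀ j ∈ ({1, 2, 3} : Finset ℕ),
    ‖lowX1214 c' χ j - lowInt1214 c' χ j‖ ≤ ε * alpha D

/-- **Z22:§10.u056 (i)** [Z22 p.61, tex L3089]: "the sum over `P^{0.496} ≤ dr < P^{0.498}` is equal to
`(500L′(1,χ)²/log²P) Σ_{p^{0.496}≤n<P^{0.498}} [sic] |χ(n)|λ₀ⱼ(n)φ(n)⁻¹(ῑ₃𝔣_{j6}(P^{0.498}/n)/0.498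
+ ῑ₄𝔣_{j7}(P^{0.5}/n)/0.5)(−1 + 𝔶_{1j}(P^{0.004}n)) + o(α)`". CLAIM. [cite: Zhang2022LandauSiegel, §10 p. 61] -/
def Mid1214Eval : Prop :=
  ∀ ε : ℝ, 0 < ε → ForAllLarge fun D _ χ => AssumptionA D χ → ∀ j ∈ ({1, 2, 3} : Finset ℕ),
    ‖S1214On c' χ j (bigP D ^ (0.496 : ℝ)) (bigP D ^ (0.498 : ℝ)) - midSum1214 c' χ j‖ ≤ ε * alpha D

/-- **Z22:§10.u056 (ii)** [Z22 p.61, tex L3089, second line]: "`… = (500𝔞/log P)∫₀^{0.002}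
(ῑ₃𝔣𝔣_{j6}(z)/0.498 + ῑ₄𝔣𝔣_{j7}(0.002 + z)/0.5)(−1 + 𝔶𝔶_{1j}(0.502 − z))dz + o(α)`"
(`𝔶_{1j}(P^{0.004}Pᶻ) = 𝔶𝔶_{1j}(z + 0.004) + O(𝓛⁻⁸)`, `u = 0.498 − z`). CLAIM.
[cite: Zhang2022LandauSiegel, §10 p. 61] -/
def Mid1214Int : Prop :=
  ∀ ε : ℝ, 0 < ε → ForAllLarge fun D _ χ => AssumptionA D χ → ∀ j ∈ ({1, 2, 3} : Finset ℕ),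
    ‖midSum1214 c' χ j - midInt1214 χ j‖ ≤ ε * alpha D

/-- **Z22:§10.u057 (i)** [Z22 p.61, tex L3101]: "the sum over `P^{0.498} ≤ dr < P^{0.5}` is equal to
`(1000ῑ₄L′(1,χ)²/log²P) Σ_{p^{0.498}≤n<P^{0.5}} [sic] |χ(n)|λ₀ⱼ(n)φ(n)⁻¹𝔣_{j7}(P^{0.5}/n)
(1 + 𝔶_{2j}(P^{0.004}n)) + o(α)`". CLAIM. [cite: Zhang2022LandauSiegel, §10 p. 61] -/
def Top1214Eval : Prop :=
  ∀ ε : ℝ, 0 < ε → ForAllLarge fun D _ χ => AssumptionA D χ → ∀ j ∈ ({1, 2, 3} : Finset ℕ),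
    ‖S1214On c' χ j (bigP D ^ (0.498 : ℝ)) (bigP D ^ (0.5 : ℝ)) - topSum1214 c' χ j‖ ≤ ε * alpha D

/-- **Z22:§10.u057 (ii)** [Z22 p.61, tex L3101, second line]: "`… = (1000ῑ₄𝔞/log P)∫₀^{0.002}𝔣𝔣_{j7}(z)
(1 + 𝔶𝔶_{2j}(0.504 − z))dz + o(α)`" (`u = 0.5 − z`). CLAIM. [cite: Zhang2022LandauSiegel, §10 p. 61] -/
def Top1214Int : Prop :=
  ∀ ε : ℝ, 0 < ε → ForAllLarge fun D _ χ => AssumptionA D χ → ∀ j ∈ ({1, 2, 3} : Finset ℕ),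
    ‖topSum1214 c' χ j - topInt1214 χ j‖ ≤ ε * alpha D

/-- **Z22:§10.u058** [Z22 p.61, tex L3111]: "Gathering the above results together we conclude
`α⁻¹S_j(𝐚₁₂,𝐚₁₄) = (d′_{6j} + d_{6j})𝔞 + o(1)`" with the printed `d′_{6j}` (10.15) and `d_{6j}`
(the tree's `d6p1–3`, `d61–63`, Z22:(10.15), Z22:§10.u059). CLAIM. [cite: Zhang2022LandauSiegel, §10 p. 61] -/
def Gather1214 : Prop :=
  ∀ ε : ℝ, 0 < ε → ForAllLarge fun D _ χ => AssumptionA D χ → ∀ j ∈ ({1, 2, 3} : Finset ℕ),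
    ‖(alpha D : ℂ)⁻¹ * Sj c' D j (a12 χ) (a14 χ) - (d6pJ j + d6J j) * frakA χ‖ ≤ ε

/-- **Z22:(10.16)** [Z22 p.61, (10.16), tex L3130]: "Hence, by Proposition 7.1,
`Θ₁(𝐚₁₂,𝐚₁₄) = (½(d′₆₁ + d₆₁) + 2(d′₆₂ + d₆₂) + 3/2(d′₆₃ + d₆₃))𝔞𝔓 + o(𝔓)` (10.16)" — typed in the
reading consistent with (10.14), with "Gathering … `(d′_{6j} + d_{6j})𝔞`" two lines above and with the
definition of `𝔡` after (10.17) (coefficient `3/2` on BOTH `d′₆₃` and `d₆₃`); the display as printed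
has the unbalanced "`+ 3/2 d′₆₃ + d₆₃)`", recorded as `Eq1016Verbatim`. CLAIM.
[cite: Zhang2022LandauSiegel, §10 (10.16) p. 61] -/
def Eq1016 : Prop :=
  ∀ ε : ℝ, 0 < ε → ForAllLarge fun D _ χ => AssumptionA D χ →
    ‖Theta1 c' χ (a12 χ) (a14 χ) -
        (1 / 2 * (d6p1 + d61) + 2 * (d6p2 + d62) + 3 / 2 * (d6p3 + d63)) * frakA χ * frakP D‖
      ≤ ε * frakP D

/-- **Z22:(10.16), literal parse** [Z22 p.61, (10.16), tex L3130]: the display reads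
"`\bigg(\frac12(d_{61}'+d_{61})+2(d_{62}'+d_{62})+\frac32 d_{63}'+d_{63})\bigg)`", i.e. literally the
coefficient `3/2` on `d′₆₃` and `1` on `d₆₃`. Recorded for the adjudicators; the consistent reading is
`Eq1016` (the two differ by `½d₆₃𝔞𝔓`). CLAIM (as printed). [cite: Zhang2022LandauSiegel, §10 (10.16) p. 61] -/
def Eq1016Verbatim : Prop :=
  ∀ ε : ℝ, 0 < ε → ForAllLarge fun D _ χ => AssumptionA D χ →
    ‖Theta1 c' χ (a12 χ) (a14 χ) -
        (1 / 2 * (d6p1 + d61) + 2 * (d6p2 + d62) + 3 / 2 * d6p3 + d63) * frakA χ * frakP D‖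
      ≤ ε * frakP D

/-- **The manuscript's deduction of the range claims for `S_j(𝐚₁₂,𝐚₁₄)`** (p. 60–61): "By a result
similar to Lemma 10.2 [the shifted Lemma 10.2 of the Remark p. 57, L3-t2's node, passed as the argument
`shiftedLemma102`] and the results in Section 8 [Lemmas 8.2–8.4]" ⊢ the range claims. Refines
`Skeleton.Ded1017`. CLAIM (deduction node). [cite: Zhang2022LandauSiegel, §10 pp. 60–61] -/
def DedRanges1214 (shiftedLemma102 : Prop) : Prop :=
  shiftedLemma102 → Lemma82 c' → Lemma83 c' → Lemma84 c' →
    Low1214Eval c' ∧ Low1214X c' ∧ Low1214Int c' ∧ Mid1214Eval c' ∧ Mid1214Int c' ∧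
      Top1214Eval c' ∧ Top1214Int c'

/-- **The manuscript's deduction of (10.16)** (p. 61): expansion, split, range claims, gathering, "Hence,
by Proposition 7.1 [`Skeleton.Prop71`], (10.16)". Refines `Skeleton.Ded1017`. CLAIM (deduction node).
[cite: Zhang2022LandauSiegel, §10 (10.16) p. 61] -/
def Ded1016 : Prop :=
  SjExpand1214 c' → Split1214 c' → Low1214Eval c' → Low1214X c' → Low1214Int c' →
    Mid1214Eval c' → Mid1214Int c' → Top1214Eval c' → Top1214Int c' → Gather1214 c' →
      Prop71 c' → Eq1016 c'

end Claims1214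

/-! ## (10.17) and the `𝔡′/𝔡` endgame — Z22:(10.17), Z22:§10.u060–u067 -/

section Endgame

variable (c' : ℝ)

/-- **Z22:§10.u060 by reference** [Z22 p.61, tex L3143]: the printed
"`𝔡′ = ½(d′₅₁ + conj d′₆₁) + 2(d′₅₂ + conj d′₆₂) + 3/2(d′₅₃ + conj d′₆₃)`" IS the tree's `dprime`
(`Section10Defs`), definitionally. [cite: Zhang2022LandauSiegel, §10 (10.17) p. 61] -/
theorem dprime_display :
    dprime = 1 / 2 * (d5p1 + conj d6p1) + 2 * (d5p2 + conj d6p2) + 3 / 2 * (d5p3 + conj d6p3) := rfl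

/-- **Z22:§10.u061 by reference** [Z22 p.62, tex L3146]: the printed
"`𝔡 = ½(d₃₁ + d₅₁ + conj(d₄₁ + d₆₁)) + 2(d₃₂ + d₅₂ + conj(d₄₂ + d₆₂)) + 3/2(d₃₃ + d₅₃ + conj(d₄₃ + d₆₃))`"
IS the tree's `dfrak` (`Section10Defs`), definitionally. [cite: Zhang2022LandauSiegel, §10 (10.17) p. 62] -/
theorem dfrak_display :
    dfrak = 1 / 2 * (d31 + d51 + conj (d41 + d61)) + 2 * (d32 + d52 + conj (d42 + d62)) +
      3 / 2 * (d33 + d53 + conj (d43 + d63)) := rfl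

/-- **Z22:§10.u062** [Z22 p.62, tex L3150]: "For `μ = 6, 7`, `𝔣𝔣_{jμ}(0) = 𝔤𝔥_{jμ}(0) = 1`" (the twelve
functions (8.13)–(8.18), the tree's `ff16 … gh37`). NUM:N-16. CLAIM — and a theorem, `ffGhAtZero_holds`.
[cite: Zhang2022LandauSiegel, §10 p. 62] -/
def FfGhAtZero : Prop :=
  (ff16 0 = 1 ∧ ff26 0 = 1 ∧ ff36 0 = 1 ∧ ff17 0 = 1 ∧ ff27 0 = 1 ∧ ff37 0 = 1) ∧
    (gh16 0 = 1 ∧ gh26 0 = 1 ∧ gh36 0 = 1 ∧ gh17 0 = 1 ∧ gh27 0 = 1 ∧ gh37 0 = 1)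

/-- `𝔣𝔣(0) = 1` for the generic shape `(1 + aπiz)e^{kπiz}`. [cite: Zhang2022LandauSiegel, §8 (8.13)–(8.18)] -/
private theorem ffF_zero (a k : ℚ) : ffF a k 0 = 1 := by
  simp [ffF]

/-- `𝔤𝔥(0) = r₀ + r₁` for the generic shape `r₀ + (r₁ + bπiz)e^{−kπiz}`. [cite: Zhang2022LandauSiegel, §8 (8.13)–(8.18)] -/
private theorem ghF_zero (r0 r1 b k : ℚ) : ghF r0 r1 b k 0 = r0 + r1 := by
  simp [ghF]

/-- **Z22:§10.u062 holds**: `𝔣𝔣_{jμ}(0) = 𝔤𝔥_{jμ}(0) = 1` for all six pairs `(j, μ)`, by evaluation of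
(8.13)–(8.18) at `z = 0` (`8/3 − 5/3 = 4/3 − 1/3 = 8/9 + 1/9 = 24/25 + 1/25 = 12/25 + 13/25 = 8/25 + 17/25 = 1`).
[cite: Zhang2022LandauSiegel, §10 p. 62] -/
theorem ffGhAtZero_holds : FfGhAtZero := by
  refine ⟨⟨ffF_zero _ _, ffF_zero _ _, ffF_zero _ _, ffF_zero _ _, ffF_zero _ _, ffF_zero _ _⟩, ?_⟩
  simp only [gh16, gh26, gh36, gh17, gh27, gh37, ghF_zero]
  norm_num

/-- **Z22:§10.u063** [Z22 p.62, tex L3153]: "Hence `𝔡′ ≃ −8ι₃/(0.498π)`" — a printed approximate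
equality of NUMBERS with no stated tolerance (from `𝔣𝔣(0) = 𝔤𝔥(0) = 1`: `∫₀^{0.002}𝔤𝔥 ≈ ∫₀^{0.002}𝔣𝔣
≈ 0.002`, weights `½ + 2 + 3/2 = 4`). Typed, per the layer convention for "`≃`", as the two-sided
REAL-PART enclosure with the slack `0.04` that the next display USES ("`Re 𝔡′ > −(8/(0.498π))Re ι₃
− 0.04`", the tree's `Ineq10a`); the imaginary part is not used in print. NUM:N-05 (`plan/NUMERICS.tsv`).
CLAIM — and a theorem, `dprimeApprox_holds`. [cite: Zhang2022LandauSiegel, §10 p. 62] -/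
def DprimeApprox : Prop := |dprime.re - (-(8 / (0.498 * π)) * iota3.re)| < 0.04

/-- **Z22:§10.u063 holds** (in the typed real-part form): the tree's certificate gives
`5.1459 < Re 𝔡′ < 5.14591` (`dprime_re_bounds`) and `5.145881 < −(8/(0.498π))Re ι₃ < 5.145883`
(`crude10_eq`, `crude10_overPi_bounds`), so the two differ by less than `3·10⁻⁵ < 0.04`.
[cite: Zhang2022LandauSiegel, §10 p. 62] -/
theorem dprimeApprox_holds : DprimeApprox := by
  unfold DprimeApprox
  rw [crude10_eq, abs_sub_lt_iff]
  constructor <;>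
    linarith [crude10_overPi_bounds.1, crude10_overPi_bounds.2, dprime_re_bounds.1, dprime_re_bounds.2]

/-- **Z22:§10.u065** [Z22 p.62, tex L3161]: "The contribution from `𝔡` is minor since if `z` is close
to `1/2`, then for `μ = 1, 2`, `𝔶𝔶_{μj}(z) ≃ 0`" — a heuristic approximate statement with no printed
tolerance; in `𝔡` the profiles `𝔶𝔶_{1j}`, `𝔶𝔶_{2j}` are evaluated on `[0.5, 0.502]`, `[0.502, 0.504]`
(in `d₃ⱼ` and, via `𝔶𝔶_{1j}(0.502 − z)`, `𝔶𝔶_{2j}(0.504 − z)` with `0 ≤ z ≤ 0.002`, in `d₆ⱼ`). Typed with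
the tolerance `δ` as an explicit PARAMETER over `z ∈ [0.5, 0.504]` (the text USES only the outcome
`|Re 𝔡| < 0.1`, the tree's `Ineq10c`, certified, NUM:N-05). NUM:pending for the `𝔶𝔶`-tolerance itself
(no `plan/NUMERICS.tsv` row; e.g. `δ = 0.1` is expected to hold:
`sup |𝔶𝔶| ≈ 0.07`, not certified here). CLAIM. [cite: Zhang2022LandauSiegel, §10 p. 62] -/
def YYNearHalfSmall (δ : ℝ) : Prop :=
  ∀ j ∈ ({1, 2, 3} : Finset ℕ), ∀ z : ℝ, 0.5 ≤ z → z ≤ 0.504 → ‖yyJ1 j z‖ ≤ δ ∧ ‖yyJ2 j z‖ ≤ δ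

/-- **"Combining these bounds with (10.16) [sic: (10.17)] we complete the proof of Proposition 2.4"**
[Z22 p.62, tex L3167] — the numerical content of that sentence, kernel-checked: the printed crude
bounds `Re 𝔡′ > −(8/(0.498π))Re ι₃ − 0.04 > 5.1` (Z22:§10.u064 = the tree's `Ineq10a`, `Ineq10b`)
and `|Re 𝔡| < 0.1` (Z22:§10.u066 = `Ineq10c`) give `Re(𝔡′ + 𝔡) > 5`, hence `|𝔡′ + 𝔡| > 5` — the tree's
`Prop24Main`, which with (10.17) (`Skeleton.Eval1017 c′`) and `𝔞 ≫ 1` yields Proposition 2.4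
(`Skeleton.prop24_of_eval`, `Skeleton.prop24_of_eval1017`). All three inputs are certified in the tree
(`Ineq10a_holds`, `Ineq10b_holds`, `Ineq10c_holds`; Remark Z22:§10.u067 = `Ineq10d`, `Ineq10d_holds`).
[cite: Zhang2022LandauSiegel, §10 p. 62] -/
theorem prop24Main_of_printed_bounds (ha : Ineq10a) (hb : Ineq10b) (hc : Ineq10c) : Prop24Main := by
  unfold Ineq10a at ha
  unfold Ineq10b at hb
  unfold Ineq10c at hc
  unfold Prop24Main
  have hre : (5 : ℝ) < (dprime + dfrak).re := by
    rw [Complex.add_re]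
    have := (abs_lt.mp hc).1
    linarith
  exact lt_of_lt_of_le hre (Complex.re_le_norm _)

/-- Norm of a five-term sum. [folklore] -/
private theorem norm_add₅_le (a b c d e : ℂ) :
    ‖a + b + c + d + e‖ ≤ ‖a‖ + ‖b‖ + ‖c‖ + ‖d‖ + ‖e‖ := by
  calc ‖a + b + c + d + e‖ ≤ ‖a + b + c + d‖ + ‖e‖ := norm_add_le _ _
    _ ≤ ‖a + b + c‖ + ‖d‖ + ‖e‖ := by gcongr; exact norm_add_le _ _
    _ ≤ ‖a + b‖ + ‖c‖ + ‖d‖ + ‖e‖ := by gcongr; exact norm_add_le _ _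
    _ ≤ ‖a‖ + ‖b‖ + ‖c‖ + ‖d‖ + ‖e‖ := by gcongr; exact norm_add_le _ _

/-- **Z22:(10.17) as a kernel EDGE** [Z22 p.61, (10.17), tex L3137–L3139]: "It follows from (10.1) and
(10.12)–(10.16) that `Ξ₁* = (𝔡′ + 𝔡)𝔞𝔓 + o(𝔓)` (10.17)" — PROVED as an implication between the typed
nodes: (10.1) (`Skeleton.Eq101 c′`), (10.12) and (10.13) (L3-t2's nodes in `TypedSection10B`, taken
here as hypotheses in the printed shape `Θ₁(𝐚₁₁,𝐚₁₃) = (½d₃₁ + 2d₃₂ + 3/2d₃₃)𝔞𝔓 + o(𝔓)`,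
`Θ₁(𝐚₁₃,𝐚₂₁) = (½d₄₁ + 2d₄₂ + 3/2d₄₃)𝔞𝔓 + o(𝔓)`), (10.14) (`Eq1014`), (10.16) (`Eq1016`) ⊢ (10.17)
(`Skeleton.Eval1017 c′`). The bookkeeping: the four main terms, two of them conjugated as in (10.1)
(`𝔞`, `𝔓` real), add up to `𝔡′ + 𝔡` EXACTLY by the printed definitions of `𝔡′`, `𝔡` (u060, u061). This
refines the banked coarse deduction node `Skeleton.Ded1017`. [cite: Zhang2022LandauSiegel, §10 (10.17) p. 61] -/
theorem eval1017_of_eqs (h101 : Eq101 c')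
    (h1012 : ∀ ε : ℝ, 0 < ε → ForAllLarge fun D _ χ => AssumptionA D χ →
      ‖Theta1 c' χ (a11 χ) (a13 χ) - (1 / 2 * d31 + 2 * d32 + 3 / 2 * d33) * frakA χ * frakP D‖
        ≤ ε * frakP D)
    (h1013 : ∀ ε : ℝ, 0 < ε → ForAllLarge fun D _ χ => AssumptionA D χ →
      ‖Theta1 c' χ (a13 χ) (a21 χ) - (1 / 2 * d41 + 2 * d42 + 3 / 2 * d43) * frakA χ * frakP D‖
        ≤ ε * frakP D)
    (h1014 : Eq1014 c') (h1016 : Eq1016 c') : Eval1017 c' := by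
  intro ε hε
  have hε5 : 0 < ε / 5 := by positivity
  have H := ((((h101 _ hε5).and (h1012 _ hε5)).and (h1013 _ hε5)).and (h1014 _ hε5)).and
    (h1016 _ hε5)
  refine H.mono fun D _ χ _ _ h hA => ?_
  obtain ⟨⟨⟨⟨e1, e2⟩, e3⟩, e4⟩, e5⟩ := h
  replace e1 := e1 hA
  replace e2 := e2 hA
  replace e3 := e3 hA
  replace e4 := e4 hA
  replace e5 := e5 hA
  have key : xiStar1 c' χ - (dprime + dfrak) * frakA χ * frakP D =
      (xiStar1 c' χ - (Theta1 c' χ (a11 χ) (a13 χ) + conj (Theta1 c' χ (a13 χ) (a21 χ)) +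
          Theta1 c' χ (a14 χ) (a22 χ) + conj (Theta1 c' χ (a12 χ) (a14 χ)))) +
        (Theta1 c' χ (a11 χ) (a13 χ) - (1 / 2 * d31 + 2 * d32 + 3 / 2 * d33) * frakA χ * frakP D) +
        conj (Theta1 c' χ (a13 χ) (a21 χ) -
          (1 / 2 * d41 + 2 * d42 + 3 / 2 * d43) * frakA χ * frakP D) +
        (Theta1 c' χ (a14 χ) (a22 χ) -
          (1 / 2 * (d5p1 + d51) + 2 * (d5p2 + d52) + 3 / 2 * (d5p3 + d53)) * frakA χ * frakP D) +
        conj (Theta1 c' χ (a12 χ) (a14 χ) -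
          (1 / 2 * (d6p1 + d61) + 2 * (d6p2 + d62) + 3 / 2 * (d6p3 + d63)) * frakA χ * frakP D) := by
    simp only [dprime, dfrak, map_add, map_sub, map_mul, map_div₀, map_ofNat, map_one,
      Complex.conj_ofReal]
    ring
  rw [key]
  refine (norm_add₅_le _ _ _ _ _).trans ?_
  rw [RCLike.norm_conj, RCLike.norm_conj]
  linarith

end Endgame

/-! ## The §10 proof of Proposition 2.4 as one deduction node — Z22:Prop2.4.pf -/

section DedProp24

variable (c' : ℝ)

/-- `Z22:Prop2.4.pf` DED — **the §10 proof of Proposition 2.4 as ONE implication** over the typed steps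
(layer naming convention: `DedProp24`, owner L3-t8; refines the banked coarse node `Skeleton.Ded1017 c′`
and the edge `Skeleton.prop24_of_eval1017`): (10.1) (`Skeleton.Eq101 c′`, "By Lemma 8.1") → (10.12)
→ (10.13) (L3-t2's nodes `Eq1012`/`Eq1013` of `TypedSection10B`, entering here as hypotheses quoted in
their printed shape `Θ₁(𝐚₁₁,𝐚₁₃) = (½d₃₁ + 2d₃₂ + 3/2d₃₃)𝔞𝔓 + o(𝔓)`,
`Θ₁(𝐚₁₃,𝐚₂₁) = (½d₄₁ + 2d₄₂ + 3/2d₄₃)𝔞𝔓 + o(𝔓)`) → (10.14) (`Eq1014 c′`) → (10.16) (`Eq1016 c′`) →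
the printed crude bounds `Re 𝔡′ > −(8/(0.498π))Re ι₃ − 0.04 > 5.1`, `|Re 𝔡| < 0.1` (Z22:§10.u064,
u066 = the tree's `Ineq10a`, `Ineq10b`, `Ineq10c`) → "(A) implies `𝔞 ≫ 1`" (§2 p. 6,
`Skeleton.FrakALowerBound`, used tacitly to absorb `o(𝔓)` into `𝔞𝔓`) → Proposition 2.4
(`Skeleton.Prop24 c′`). CLAIM as a deduction node — and a THEOREM: `dedProp24_holds`.
[cite: Zhang2022LandauSiegel, §10 pp. 53–62] -/
def DedProp24 : Prop :=
  Eq101 c' →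
    (∀ ε : ℝ, 0 < ε → ForAllLarge fun D _ χ => AssumptionA D χ →
      ‖Theta1 c' χ (a11 χ) (a13 χ) - (1 / 2 * d31 + 2 * d32 + 3 / 2 * d33) * frakA χ * frakP D‖
        ≤ ε * frakP D) →
    (∀ ε : ℝ, 0 < ε → ForAllLarge fun D _ χ => AssumptionA D χ →
      ‖Theta1 c' χ (a13 χ) (a21 χ) - (1 / 2 * d41 + 2 * d42 + 3 / 2 * d43) * frakA χ * frakP D‖
        ≤ ε * frakP D) →
    Eq1014 c' → Eq1016 c' → Ineq10a → Ineq10b → Ineq10c → FrakALowerBound → Prop24 c'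

/-- `Z22:Prop2.4.pf` DED holds: **the §10 deduction is kernel-checked modulo its typed analytic
inputs** — from (10.1), (10.12), (10.13), (10.14), (10.16) (claims), the printed crude bounds
(certified in the tree: `Ineq10a_holds`, `Ineq10b_holds`, `Ineq10c_holds`) and `𝔞 ≫ 1`
(`Skeleton.frakALowerBound_holds`), Proposition 2.4 follows: `eval1017_of_eqs` ((10.17)), then
`prop24Main_of_printed_bounds` and the banked `Skeleton.prop24_of_eval`. So the open content of §10 is
exactly the five analytic claims (and, below them, Prop. 7.1, Lemma 8.1, Lemmas 8.2–8.4, 10.1–10.2 and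
their shifted forms). [cite: Zhang2022LandauSiegel, §10 pp. 53–62] -/
theorem dedProp24_holds : DedProp24 c' := by
  intro h101 h1012 h1013 h1014 h1016 ha hb hc hA
  exact prop24_of_eval (eval1017_of_eqs c' h101 h1012 h1013 h1014 h1016)
    (prop24Main_of_printed_bounds ha hb hc) hA

/-- `DedProp24` — `_holds` alias of `dedProp24_holds` above under the fact's exact name (appended
2026-08-28, D-0026 bookkeeping: the proof term is the existing theorem of this file; no statement,
definition or attribute is edited; no new named fact; the ledger's debt table listed the fact
unproved). [cite: Zhang2022LandauSiegel, §10 pp. 53–62] -/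
theorem _root_.Literature.NumberTheory.LFunctions.Zhang2022.Typed.Sec10C.DedProp24_holds :
    DedProp24 c' :=
  _root_.Literature.NumberTheory.LFunctions.Zhang2022.Typed.Sec10C.dedProp24_holds (c' := c')

/-- `Z22:Prop2.4.pf` — **Proposition 2.4 from the five analytic claims of §10 alone** (the numerical
inputs and `𝔞 ≫ 1` discharged from the tree). [cite: Zhang2022LandauSiegel, §10 pp. 53–62] -/
theorem prop24_of_section10_claims (h101 : Eq101 c')
    (h1012 : ∀ ε : ℝ, 0 < ε → ForAllLarge fun D _ χ => AssumptionA D χ →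
      ‖Theta1 c' χ (a11 χ) (a13 χ) - (1 / 2 * d31 + 2 * d32 + 3 / 2 * d33) * frakA χ * frakP D‖
        ≤ ε * frakP D)
    (h1013 : ∀ ε : ℝ, 0 < ε → ForAllLarge fun D _ χ => AssumptionA D χ →
      ‖Theta1 c' χ (a13 χ) (a21 χ) - (1 / 2 * d41 + 2 * d42 + 3 / 2 * d43) * frakA χ * frakP D‖
        ≤ ε * frakP D)
    (h1014 : Eq1014 c') (h1016 : Eq1016 c') : Prop24 c' :=
  dedProp24_holds c' h101 h1012 h1013 h1014 h1016 Ineq10a_holds Ineq10b_holds Ineq10c_holds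
    frakALowerBound_holds

end DedProp24

/-! ## Z22:§10.u065 discharged: `𝔶𝔶_{μj}(z) ≃ 0` near `z = 1/2` with an explicit tolerance

Append #2 (L3-t8, theorem-only). The heuristic sentence [Z22 p.62, tex L3161] "if `z` is close to
`1/2`, then for `μ = 1, 2`, `𝔶𝔶_{μj}(z) ≃ 0`" was typed above as `YYNearHalfSmall δ` with the tolerance a
PARAMETER (none is printed). It HOLDS with `δ = 7/100` on the whole range `z ∈ [0.5, 0.504]` used in
`𝔡`: by the triangle inequality and `π < 3.15`, `‖𝔶𝔶_{1j}(z)‖ ≤ 5π·0.004 + 3π²·(0.004² + 2·0.002²) <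
0.0636` and `‖𝔶𝔶_{2j}(z)‖ ≤ 5π·0.004 + 3π²·0.004² < 0.0633` (`|s| ≤ 5`, `|h| ≤ 3` in the tree's
`yy1F s h`, `yy2F s h`); the actual suprema are `≈ 0.0629`. Nothing here is used by the proof of
Proposition 2.4 (which consumes only `|Re 𝔡| < 0.1`, the certified `Ineq10c`); it closes the DAG node.
[cite: Zhang2022LandauSiegel, §10 p. 62]
-/

section YYNearHalf

/-- Triangle-inequality bound for the generic profile
`𝔶𝔶₁(z) = sπi(z − 0.5) + hπ²((0.504 − z)² − 2(0.502 − z)²)` (tree `yy1F`). [folklore] -/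
private theorem norm_yy1F_le (s h : ℚ) (z : ℝ) :
    ‖yy1F s h z‖ ≤ |(s : ℝ)| * π * |z - 0.5| +
      |(h : ℝ)| * π ^ 2 * ((0.504 - z) ^ 2 + 2 * (0.502 - z) ^ 2) := by
  have hre : yy1F s h z =
      ((((s : ℝ) * π * (z - 0.5) : ℝ) : ℂ)) * I +
        (((h : ℝ) * π ^ 2 * ((0.504 - z) ^ 2 - 2 * (0.502 - z) ^ 2) : ℝ) : ℂ) := by
    unfold yy1F; push_cast; ring
  rw [hre]
  refine (norm_add_le _ _).trans ?_
  rw [norm_mul, Complex.norm_I, mul_one, Complex.norm_real, Complex.norm_real, Real.norm_eq_abs,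
    Real.norm_eq_abs, abs_mul, abs_mul, abs_of_pos Real.pi_pos, abs_mul, abs_mul,
    abs_of_pos (by positivity : (0 : ℝ) < π ^ 2)]
  gcongr
  refine (abs_sub _ _).trans ?_
  rw [abs_of_nonneg (sq_nonneg _), abs_mul, abs_of_pos (by norm_num : (0:ℝ) < 2),
    abs_of_nonneg (sq_nonneg _)]

/-- Triangle-inequality bound for `𝔶𝔶₂(z) = sπi(0.504 − z) + hπ²(0.504 − z)²` (tree `yy2F`). [folklore] -/
private theorem norm_yy2F_le (s h : ℚ) (z : ℝ) :
    ‖yy2F s h z‖ ≤ |(s : ℝ)| * π * |0.504 - z| + |(h : ℝ)| * π ^ 2 * (0.504 - z) ^ 2 := by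
  have hre : yy2F s h z =
      ((((s : ℝ) * π * (0.504 - z) : ℝ) : ℂ)) * I +
        (((h : ℝ) * π ^ 2 * (0.504 - z) ^ 2 : ℝ) : ℂ) := by
    unfold yy2F; push_cast; ring
  rw [hre]
  refine (norm_add_le _ _).trans ?_
  rw [norm_mul, Complex.norm_I, mul_one, Complex.norm_real, Complex.norm_real, Real.norm_eq_abs,
    Real.norm_eq_abs, abs_mul, abs_mul, abs_of_pos Real.pi_pos, abs_mul, abs_mul,
    abs_of_pos (by positivity : (0 : ℝ) < π ^ 2), abs_of_nonneg (sq_nonneg (0.504 - z))]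

/-- On `[0.5, 0.504]`, for `|s| ≤ 5`, `|h| ≤ 3`: `‖yy1F s h z‖ ≤ 7/100`. [folklore] -/
private theorem norm_yy1F_le_of (s h : ℚ) (hs : |(s : ℝ)| ≤ 5) (hh : |(h : ℝ)| ≤ 3) {z : ℝ}
    (hz1 : 0.5 ≤ z) (hz2 : z ≤ 0.504) : ‖yy1F s h z‖ ≤ 7 / 100 := by
  refine (norm_yy1F_le s h z).trans ?_
  have hπ := Real.pi_lt_d2
  have hπ0 := Real.pi_pos
  have h1 : |z - 0.5| ≤ 0.004 := by rw [abs_le]; constructor <;> linarith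
  have h2 : (0.504 - z) ^ 2 + 2 * (0.502 - z) ^ 2 ≤ 0.000024 := by nlinarith
  have hπ2 : π ^ 2 ≤ 3.15 ^ 2 := by nlinarith
  calc |(s : ℝ)| * π * |z - 0.5| + |(h : ℝ)| * π ^ 2 * ((0.504 - z) ^ 2 + 2 * (0.502 - z) ^ 2)
      ≤ 5 * 3.15 * 0.004 + 3 * 3.15 ^ 2 * 0.000024 := by
        gcongr
    _ ≤ 7 / 100 := by norm_num

/-- On `[0.5, 0.504]`, for `|s| ≤ 5`, `|h| ≤ 3`: `‖yy2F s h z‖ ≤ 7/100`. [folklore] -/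
private theorem norm_yy2F_le_of (s h : ℚ) (hs : |(s : ℝ)| ≤ 5) (hh : |(h : ℝ)| ≤ 3) {z : ℝ}
    (hz1 : 0.5 ≤ z) (hz2 : z ≤ 0.504) : ‖yy2F s h z‖ ≤ 7 / 100 := by
  refine (norm_yy2F_le s h z).trans ?_
  have hπ := Real.pi_lt_d2
  have hπ0 := Real.pi_pos
  have h1 : |0.504 - z| ≤ 0.004 := by rw [abs_le]; constructor <;> linarith
  have h2 : (0.504 - z) ^ 2 ≤ 0.000016 := by nlinarith
  calc |(s : ℝ)| * π * |0.504 - z| + |(h : ℝ)| * π ^ 2 * (0.504 - z) ^ 2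
      ≤ 5 * 3.15 * 0.004 + 3 * 3.15 ^ 2 * 0.000016 := by
        gcongr
    _ ≤ 7 / 100 := by norm_num

/-- Monotonicity of `YYNearHalfSmall` in the tolerance. [folklore] -/
private theorem yyNearHalfSmall_mono {δ δ' : ℝ} (hle : δ ≤ δ') (h : YYNearHalfSmall δ) :
    YYNearHalfSmall δ' := fun j hj z hz1 hz2 =>
  ⟨(h j hj z hz1 hz2).1.trans hle, (h j hj z hz1 hz2).2.trans hle⟩

/-- **Z22:§10.u065 DISCHARGED** [Z22 p.62, tex L3161] with the explicit tolerance `δ = 7/100`: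
for `j ∈ {1,2,3}` and `0.5 ≤ z ≤ 0.504`, `‖𝔶𝔶_{1j}(z)‖ ≤ 0.07` and `‖𝔶𝔶_{2j}(z)‖ ≤ 0.07`.
[cite: Zhang2022LandauSiegel, §10 p. 62] -/
theorem yyNearHalfSmall_holds : YYNearHalfSmall (7 / 100) := by
  intro j hj z hz1 hz2
  simp only [Finset.mem_insert, Finset.mem_singleton] at hj
  have h5 : |((5 : ℚ) : ℝ)| ≤ 5 := by norm_num
  have h4 : |((4 : ℚ) : ℝ)| ≤ 5 := by norm_num
  have h3 : |((3 : ℚ) : ℝ)| ≤ 5 := by norm_num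
  have g3 : |((-3 : ℚ) : ℝ)| ≤ 3 := by norm_num
  have g32 : |((-3/2 : ℚ) : ℝ)| ≤ 3 := by norm_num
  have g1 : |((-1 : ℚ) : ℝ)| ≤ 3 := by norm_num
  rcases hj with rfl | rfl | rfl
  · simp only [yyJ1, yyJ2, byJ, if_true, yy11, yy21]
    exact ⟨norm_yy1F_le_of _ _ h5 g3 hz1 hz2, norm_yy2F_le_of _ _ h5 g3 hz1 hz2⟩
  · simp only [yyJ1, yyJ2, byJ, if_true, yy12, yy22, show (2:ℕ) ≠ 1 by decide, if_false]
    exact ⟨norm_yy1F_le_of _ _ h4 g32 hz1 hz2, norm_yy2F_le_of _ _ h4 g32 hz1 hz2⟩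
  · simp only [yyJ1, yyJ2, byJ, yy13, yy23, show (3:ℕ) ≠ 1 by decide, show (3:ℕ) ≠ 2 by decide,
      if_false]
    exact ⟨norm_yy1F_le_of _ _ h3 g1 hz1 hz2, norm_yy2F_le_of _ _ h3 g1 hz1 hz2⟩

/-- The tolerance `δ = 1/10` named in the docstring of `YYNearHalfSmall`. [cite: Zhang2022LandauSiegel, §10 p. 62] -/
theorem yyNearHalfSmall_tenth : YYNearHalfSmall (1 / 10) :=
  yyNearHalfSmall_mono (by norm_num) yyNearHalfSmall_holds

end YYNearHalf

end Literature.NumberTheory.LFunctions.Zhang2022.Typed.Sec10C
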